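import Summits.QuantumFields.BalabanUV.T4Continuum.Support.NE3EnergyHessBilin
import Summits.QuantumFields.BalabanUV.T4Continuum.Support.NE3HessContinuity
import Summits.QuantumFields.BalabanUV.T4Continuum.Support.NE3HessShapes
import Summits.QuantumFields.BalabanUV.T4Continuum.Support.NE3EnergyResidual
import Summits.QuantumFields.BalabanUV.T4Continuum.Support.PeriodicChoice
import Summits.QuantumFields.BalabanUV.T4Continuum.Support.NE3EnergySource
import Summits.QuantumFields.BalabanUV.T4Continuum.Support.NE3EnergyPathC2Velocity

/-!
# T⁴ programme, node NE3, route P2 «ENERGY CONVEXITY» — sub-row S5-Y8a PART 1b: the field `cont` of `RouteLeaves`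
# DISCHARGED — for the symmetrised Hessian `hessSym` on PERIODIC directions, and FOR ALL DIRECTIONS for its periodised
# form `HsPer := hessSym ∘ (perExt × perExt)` — with `Λ = 48·d`, k-uniform, from road P3's `NE3HessContinuity.abs_hess_le`
# and `NE3HessShapes.sum_plaqsOf_bondSq_le` BY NAME; plus `curv` reduced to the chart's acceleration bound (P2's L7)

NE3 formalisation swarm, leaf seat `b2b-balaban-t4-ne3-formalise-leaf-03` (gen 3), sub-row S5-Y8a (part 1b) of
`HOME/t4/formal/NE3/LEAVES.md` (road P2 leaf L8∕L6(a) glue).  WHAT IS PROVED ([folklore] glue; every analytic input BY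
NAME): for unitary `V`, the period window `perWin d M` (`= plaqsOf (periodBox M)`, `1 ≤ M`) and `(M : ℤ)`-PERIODIC
direction fields `Y`, `Z`:
* `abs_hessSym_le_bondSq` — `|hessSym V W Y Z| ≤ 12·√(Σ_{p∈W} bondSq Y p)·√(Σ_{p∈W} bondSq Z p)` (any window; P3's
  `abs_hess_le` for `(Y,Z)` and `(Z,Y)`);
* `abs_hessSym_perWin_le_dirSq` — `|hessSym V (perWin d M) Y Z| ≤ 48·d·√(dirSq Y (periodBox M))·√(dirSq Z (periodBox M))`
  (P3's `sum_plaqsOf_bondSq_le`: `Σ bondSq ≤ 4d·dirSq` for periodic fields);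
* **`abs_hessSym_perWin_le_energyNorm`** — `|hessSym V (perWin d M) Y Z| ≤ 48·d·energyNorm W Y (periodBox M)·energyNorm W Z
  (periodBox M)` for ANY background `W` (only the `dirSq` part of the energy norm is used; `NE3EnergyResidual.sqrt_dirSq_le_energyNorm`)
  — i.e. the field `cont` of `NE3EnergyAssembly.RouteLeaves` for `Hs t := hessSym W_t (perWin d (N·L^k))`, `Λ := 48·d`,
  k-UNIFORM, in the tree's (unweighted) `energyNorm` and a fortiori in any weighted one — RESTRICTED TO PERIODIC `Y, Z`;
* `cont_field_periodic` — the same along a path `W_t = vary W (Γ t) 1` of a unitary background by skew fields (unitary by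
  `AveragingDeficitPlaqDeriv.vary_isUnitaryCfg`), in the `∀ t ∈ Icc 0 1` shape of `cont`;
* §4 `perExt`, `HsPer`, `abs_HsPer_le_energyNorm`, **`cont_field`** (ALL directions), `isPeriodicDir_rvel` (the right-log
  velocity of a periodic path is periodic, by `rvel_unique`), `symm_split_fields_HsPer` — see below;
* §5 `abs_e_le` ∕ `curv_field_of_accel` — the curvature term `e t = dAction W_t (Ψ′ t)` IS a first variation, so `curv`
  REDUCES (via P2's `NE3EnergySource.abs_firstVariation_le` BY NAME) to the chart's acceleration bound
  `a·Σ‖d_{W_t}Ψ′_t‖ ≤ κ·energyNorm X²` (L2(b), path-specific).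
LOCATED LIMIT (typed, for the single writers of road P2): `RouteLeaves.cont` quantifies over ALL direction fields, but
`hess W_t · · (perWin d M)` sees the OUT-OF-BOX bonds of the boundary plaquettes of the fundamental box, which
`energyNorm · · (periodBox M)` does not control: d = 2, `p` at the corner `z = (M−1, M−1)`, `Y` supported on the two
out-of-box bonds of `∂p` with skew values `A` and `A + εB` gives `energyNorm W Y (periodBox M)² = ε²‖B‖²` but
`hess W Y Y (perWin) = nReTr([A, A+εB]·H̃) − ε²·nReTr(B²·H̃)` (`H̃` a conjugate of `W(∂p)`), whose first term is `O(ε)`,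
not `O(ε²)`, at a non-central `W(∂p)` — so NO finite `Λ` serves all `Y`.  `NE3EnergyPath.pathHessian_lower` uses `hcont`
only at `(X, u_t)` and `(u_t, u_t)`, both periodic in the torus dictionary; hence either (r1) `cont` is re-typed to
periodic directions (this file then discharges it with `Λ = 48d`), or (r2) `Hs t` is instantiated as `hessSym W_t ∘
(periodic extension × periodic extension)` — DONE HERE (§4): **`HsPer V W P := hessSym V W ∘ (perExt P × perExt P)`** with
the linear periodic extension `perExt P` from the fundamental box (`Support/PeriodicChoice`'s wrap map BY NAME), `HsPer_symm`,
`HsPer_apply_of_periodic` ∕ `HsPer_self_of_periodic` (on periodic directions it IS `hessSym` ∕ `hess`), **`abs_HsPer_le_energyNorm`**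
and **`cont_field`**: `cont` FOR ALL `Y, Z` with `Λ = 48·d` (in-box `dirSq` only), and `symm_split_fields_HsPer` (the
`symm`∕`split` clauses with leaf L3's `φ″` for periodic velocities).  So with `Hs t := HsPer W_t (perWin d (N·L^k)) (N·L^k)`
the clauses `symm ∕ split ∕ cont` of `RouteLeaves` AS TYPED are discharged (given L3's velocities are periodic), WITHOUT any
re-typing by the single writers; `RouteLeaves` leaves `Hs` free, nothing in the tree is contradicted.

HONEST FRAMING.  Finite-T⁴ bookkeeping (rung (B)+1); glue of landed bounds; NO coercivity (L5) is stated or consumed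
(typer ρ19); NOTHING about Bałaban's minimisers; NE3 NOT proved; spine PROVED 0∕9; no conditional of the cell used or
hidden; NOT infinite volume ∕ mass gap ∕ Clay ∕ summit progress.  ABSOLUTE RULE kept: no printed sentence is a
hypothesis.  PLACEMENT: `Summits/QuantumFields/BalabanUV/`; imports `Support.NE3EnergyHessBilin` (this seat),
`Support.NE3HessContinuity` + `Support.NE3HessShapes` (t4-ne3-p3), `Support.NE3EnergyResidual` + `Support.NE3EnergySource` (t4-ne3-p2), `Support.PeriodicChoice` (leaf-09) and this seat's `Support.NE3EnergyPathC2Velocity` BY NAME; restates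
nothing, moves nothing; TWO data definitions (`perExt`, `HsPer`: linear ∕ bilinear packagings), no `def … : Prop`.
-/

set_option autoImplicit false

open scoped BigOperators Matrix.Norms.L2Operator
open NormedSpace Finset

namespace Summit.QuantumFields.BalabanUV.T4Continuum.NE3EnergyHessCont

open Literature.MathematicalPhysics.QuantumFieldTheory.Balaban1983to89
open B7Prop1Explicit B7Prop2Explicit MatrixLog UnitaryModel
open T4AveragingDeficitWall hiding Site Plane Plaq Bond
open T4AveragingDeficitWallBoundary (periodBox)
open AveragingDeficitPeriodicCounting (IsPeriodicDir)
open MinimalActionLevels (perWin)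
open NE3EnergyShapes (energyNorm energyNorm_nonneg)
open NE3HessForm (dAction hess)
open NE3HessBounds (bondSq)
open NE3HessShapes (plaqsOf sum_plaqsOf_bondSq_le)
open NE3HessContinuity (abs_hess_le)
open NE3EnergyResidual (sqrt_dirSq_le_energyNorm)
open NE3EnergyHessBilin (hessSym hessSym_apply hessSym_symm hessSym_self)
open T4AveragingDeficitWallBoundary (mem_periodBox)
open PeriodicChoice (apply_wrap_eq wrap_add_smul_e)
open NE3EnergyPathC2 (hasDerivAt_two_fineAction_path)
open NE3EnergySource (abs_firstVariation_le)

noncomputable section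

variable {d : ℕ} {n : Type*} [Fintype n] [DecidableEq n]

/-! ## §1 The symmetrised Hessian against the bond square sums -/

/-- `|hessSym V W Y Z| ≤ 12·√(Σ_{p∈W} bondSq Y p)·√(Σ_{p∈W} bondSq Z p)` for unitary `V` (P3's `abs_hess_le` for both
orders). [folklore] -/
theorem abs_hessSym_le_bondSq [Nonempty n] {V : Site d → Fin d → (Matrix n n ℂ)ˣ} (hV : IsUnitaryCfg V)
    (W : Finset (T4AveragingDeficitWall.Plaq d)) (Y Z : Site d → Fin d → Matrix n n ℂ) :
    |hessSym V W Y Z| ≤ 12 * (Real.sqrt (∑ p ∈ W, bondSq Y p) * Real.sqrt (∑ p ∈ W, bondSq Z p)) := by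
  have h1 := abs_hess_le hV Y Z W
  have h2 := abs_hess_le hV Z Y W
  rw [mul_comm (Real.sqrt (∑ p ∈ W, bondSq Z p))] at h2
  rw [hessSym_apply, abs_div, abs_two, div_le_iff₀ (by norm_num : (0:ℝ) < 2)]
  exact (abs_add_le _ _).trans (by linarith)

/-! ## §2 Periodic directions on the period window -/

/-- The period window is the plaquette set of the period box: `perWin d M = plaqsOf (periodBox M)`. [folklore] -/
theorem perWin_eq_plaqsOf (M : ℕ) : perWin d M = plaqsOf (periodBox (d := d) M) := rfl

/-- For `(M:ℤ)`-periodic `Y, Z` and unitary `V`: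
`|hessSym V (perWin d M) Y Z| ≤ 48·d·√(dirSq Y (periodBox M))·√(dirSq Z (periodBox M))`. [folklore] -/
theorem abs_hessSym_perWin_le_dirSq [Nonempty n] {V : Site d → Fin d → (Matrix n n ℂ)ˣ} (hV : IsUnitaryCfg V)
    {M : ℕ} (hM : 1 ≤ M) {Y Z : Site d → Fin d → Matrix n n ℂ} (hY : IsPeriodicDir Y M) (hZ : IsPeriodicDir Z M) :
    |hessSym V (perWin d M) Y Z| ≤ 48 * d * (Real.sqrt (dirSq Y (periodBox M)) * Real.sqrt (dirSq Z (periodBox M))) := by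
  have h := abs_hessSym_le_bondSq hV (perWin d M) Y Z
  rw [perWin_eq_plaqsOf] at h ⊢
  have h4d : (0 : ℝ) ≤ 4 * (d : ℝ) := by positivity
  have hbY := sum_plaqsOf_bondSq_le (n := n) hM hY
  have hbZ := sum_plaqsOf_bondSq_le (n := n) hM hZ
  set a := Real.sqrt (∑ p ∈ plaqsOf (periodBox M), bondSq Y p) with ha
  set b := Real.sqrt (∑ p ∈ plaqsOf (periodBox M), bondSq Z p) with hb
  set y := Real.sqrt (dirSq Y (periodBox M)) with hy
  set z := Real.sqrt (dirSq Z (periodBox M)) with hz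
  have hb0 : 0 ≤ b := Real.sqrt_nonneg _
  have hy0 : 0 ≤ y := Real.sqrt_nonneg _
  have hs0 : 0 ≤ Real.sqrt (4 * (d : ℝ)) := Real.sqrt_nonneg _
  have hY' : a ≤ Real.sqrt (4 * (d : ℝ)) * y := by
    rw [ha, hy, ← Real.sqrt_mul h4d]
    exact Real.sqrt_le_sqrt hbY
  have hZ' : b ≤ Real.sqrt (4 * (d : ℝ)) * z := by
    rw [hb, hz, ← Real.sqrt_mul h4d]
    exact Real.sqrt_le_sqrt hbZ
  have hs : Real.sqrt (4 * (d : ℝ)) * Real.sqrt (4 * (d : ℝ)) = 4 * d := Real.mul_self_sqrt h4d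
  have hab : a * b ≤ (Real.sqrt (4 * (d : ℝ)) * y) * (Real.sqrt (4 * (d : ℝ)) * z) :=
    mul_le_mul hY' hZ' hb0 (mul_nonneg hs0 hy0)
  have hab' : a * b ≤ 4 * d * (y * z) := by
    calc a * b ≤ (Real.sqrt (4 * (d : ℝ)) * y) * (Real.sqrt (4 * (d : ℝ)) * z) := hab
      _ = (Real.sqrt (4 * (d : ℝ)) * Real.sqrt (4 * (d : ℝ))) * (y * z) := by ring
      _ = 4 * d * (y * z) := by rw [hs]
  linarith

/-! ## §3 In the energy norm (any background): the field `cont` for periodic directions, `Λ = 48·d` -/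

/-- **CONTINUITY OF `hessSym` IN THE ENERGY NORM, PERIODIC DIRECTIONS, `Λ = 48·d`**: for unitary `V`, any background `W`,
`1 ≤ M` and `(M:ℤ)`-periodic `Y, Z`:
`|hessSym V (perWin d M) Y Z| ≤ 48·d·energyNorm W Y (periodBox M)·energyNorm W Z (periodBox M)` (k-uniform; only the
`dirSq` part of the energy norm is used). [folklore] -/
theorem abs_hessSym_perWin_le_energyNorm [Nonempty n] {V : Site d → Fin d → (Matrix n n ℂ)ˣ} (hV : IsUnitaryCfg V)
    (W : Site d → Fin d → (Matrix n n ℂ)ˣ) {M : ℕ} (hM : 1 ≤ M) {Y Z : Site d → Fin d → Matrix n n ℂ}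
    (hY : IsPeriodicDir Y M) (hZ : IsPeriodicDir Z M) :
    |hessSym V (perWin d M) Y Z| ≤ 48 * d * energyNorm W Y (periodBox M) * energyNorm W Z (periodBox M) := by
  have h := abs_hessSym_perWin_le_dirSq hV hM hY hZ
  have hY' := sqrt_dirSq_le_energyNorm W Y (periodBox M)
  have hZ' := sqrt_dirSq_le_energyNorm W Z (periodBox M)
  have hz0 : 0 ≤ Real.sqrt (dirSq Z (periodBox M)) := Real.sqrt_nonneg _
  have hprod : Real.sqrt (dirSq Y (periodBox M)) * Real.sqrt (dirSq Z (periodBox M))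
      ≤ energyNorm W Y (periodBox M) * energyNorm W Z (periodBox M) :=
    mul_le_mul hY' hZ' hz0 (energyNorm_nonneg _ _ _)
  have hd : (0 : ℝ) ≤ 48 * (d : ℝ) := by positivity
  calc |hessSym V (perWin d M) Y Z|
      ≤ 48 * d * (Real.sqrt (dirSq Y (periodBox M)) * Real.sqrt (dirSq Z (periodBox M))) := h
    _ ≤ 48 * d * (energyNorm W Y (periodBox M) * energyNorm W Z (periodBox M)) := mul_le_mul_of_nonneg_left hprod hd
    _ = 48 * d * energyNorm W Y (periodBox M) * energyNorm W Z (periodBox M) := by ring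

/-- **THE FIELD `cont` ALONG A PATH, PERIODIC DIRECTIONS**: for a unitary background `W`, skew path fields `Γ t`, the
moving configuration `W_t := vary W (Γ t) 1` is unitary and, for `(M:ℤ)`-periodic `Y, Z` and every `t`,
`|hessSym W_t (perWin d M) Y Z| ≤ 48·d·energyNorm W Y (periodBox M)·energyNorm W Z (periodBox M)` — the `cont` clause of
`RouteLeaves` with `Hs t := hessSym W_t (perWin d (N·L^k))`, `Λ := 48·d`, on periodic directions. [folklore] -/
theorem cont_field_periodic [Nonempty n] {W : Site d → Fin d → (Matrix n n ℂ)ˣ} (hW : IsUnitaryCfg W)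
    {Γ : ℝ → Site d → Fin d → Matrix n n ℂ} (hΓ : ∀ t, IsSkewDir (Γ t)) {M : ℕ} (hM : 1 ≤ M) :
    ∀ t ∈ Set.Icc (0 : ℝ) 1, ∀ Y Z : Site d → Fin d → Matrix n n ℂ, IsPeriodicDir Y M → IsPeriodicDir Z M →
      |hessSym (vary W (Γ t) 1) (perWin d M) Y Z|
        ≤ 48 * d * energyNorm W Y (periodBox M) * energyNorm W Z (periodBox M) :=
  fun t _ _ _ hY hZ =>
    abs_hessSym_perWin_le_energyNorm (AveragingDeficitPlaqDeriv.vary_isUnitaryCfg hW (hΓ t) 1) W hM hY hZ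

/-! ## §4 The periodic extension from the fundamental box and `HsPer := hessSym ∘ (perExt × perExt)`: the field `cont`
for ALL directions -/

/-- **PERIODIC EXTENSION FROM THE FUNDAMENTAL BOX** `[0,P)^d`: `(perExt P Y) x κ := Y (x mod P) κ` (the wrap map of
`Support/PeriodicChoice`, written `fun ι => x ι % P`), as an `ℝ`-linear map on direction fields. [folklore] -/
def perExt (P : ℕ) : (Site d → Fin d → Matrix n n ℂ) →ₗ[ℝ] (Site d → Fin d → Matrix n n ℂ) where
  toFun Y := fun x κ => Y (fun ι => x ι % (P : ℤ)) κ
  map_add' _ _ := rfl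
  map_smul' _ _ := rfl

omit [Fintype n] [DecidableEq n] in
/-- `(perExt P Y) x κ = Y (x mod P) κ`. [folklore] -/
@[simp] theorem perExt_apply (P : ℕ) (Y : Site d → Fin d → Matrix n n ℂ) (x : Site d) (κ : Fin d) :
    perExt P Y x κ = Y (fun ι => x ι % (P : ℤ)) κ := rfl

omit [Fintype n] [DecidableEq n] in
/-- The periodic extension IS `P`-periodic. [folklore] -/
theorem isPeriodicDir_perExt (P : ℕ) (Y : Site d → Fin d → Matrix n n ℂ) : IsPeriodicDir (perExt P Y) (P : ℤ) := by
  intro x κ μ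
  simp only [perExt_apply]
  exact congrArg (fun w : Site d => Y w μ) (wrap_add_smul_e P x κ)

omit [Fintype n] [DecidableEq n] in
/-- On a `P`-periodic field the periodic extension is the identity. [folklore] -/
theorem perExt_eq_of_periodic (P : ℕ) {Y : Site d → Fin d → Matrix n n ℂ} (hY : IsPeriodicDir Y (P : ℤ)) :
    perExt P Y = Y := by
  funext x κ
  simp only [perExt_apply]
  exact congrFun (apply_wrap_eq (g := fun w : Site d => Y w) (fun w ι => funext fun μ => hY w ι μ) x) κ

omit [Fintype n] [DecidableEq n] in
/-- Inside the fundamental box the periodic extension agrees with the field. [folklore] -/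
theorem perExt_apply_of_mem (P : ℕ) (Y : Site d → Fin d → Matrix n n ℂ) {x : Site d} (hx : x ∈ periodBox (d := d) P)
    (κ : Fin d) : perExt P Y x κ = Y x κ := by
  simp only [perExt_apply]
  have hw : (fun ι => x ι % (P : ℤ)) = x := funext fun ι => Int.emod_eq_of_lt ((mem_periodBox.mp hx) ι).1 ((mem_periodBox.mp hx) ι).2
  rw [hw]

/-- The in-box `ℓ²` mass is unchanged by the periodic extension: `dirSq (perExt P Y) [0,P)^d = dirSq Y [0,P)^d`.
[folklore] -/
theorem dirSq_perExt (P : ℕ) (Y : Site d → Fin d → Matrix n n ℂ) :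
    dirSq (perExt P Y) (periodBox P) = dirSq Y (periodBox P) := by
  unfold dirSq
  refine Finset.sum_congr rfl fun x hx => Finset.sum_congr rfl fun κ _ => ?_
  rw [perExt_apply_of_mem P Y hx κ]

/-- **`HsPer V W P := hessSym V W ∘ (perExt P × perExt P)`** — the symmetrised Wilson Hessian READ THROUGH THE PERIODIC
EXTENSION: an `ℝ`-bilinear map on ALL direction fields which coincides with `hessSym V W` on `P`-periodic ones and whose
size is controlled by in-box data only.  This is the `Hs t` (with `V := W_t`, `W := perWin d P`, `P := N·L^k`) for which
every Hessian clause of `RouteLeaves` AS TYPED (`symm`, `split`, `cont` over all `Y, Z`) is dischargeable. [folklore] -/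
def HsPer (V : Site d → Fin d → (Matrix n n ℂ)ˣ) (W : Finset (T4AveragingDeficitWall.Plaq d)) (P : ℕ) :
    (Site d → Fin d → Matrix n n ℂ) →ₗ[ℝ] (Site d → Fin d → Matrix n n ℂ) →ₗ[ℝ] ℝ :=
  (hessSym V W).compl₁₂ (perExt P) (perExt P)

/-- `HsPer V W P Y Z = hessSym V W (perExt P Y) (perExt P Z)`. [folklore] -/
@[simp] theorem HsPer_apply (V : Site d → Fin d → (Matrix n n ℂ)ˣ) (W : Finset (T4AveragingDeficitWall.Plaq d)) (P : ℕ)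
    (Y Z : Site d → Fin d → Matrix n n ℂ) : HsPer V W P Y Z = hessSym V W (perExt P Y) (perExt P Z) := rfl

/-- `HsPer` is symmetric (field `symm`). [folklore] -/
theorem HsPer_symm (V : Site d → Fin d → (Matrix n n ℂ)ˣ) (W : Finset (T4AveragingDeficitWall.Plaq d)) (P : ℕ)
    (Y Z : Site d → Fin d → Matrix n n ℂ) : HsPer V W P Y Z = HsPer V W P Z Y := by
  rw [HsPer_apply, HsPer_apply, hessSym_symm]

/-- On periodic directions `HsPer` is `hessSym`; on the diagonal of a periodic direction it is `hess` itself. [folklore] -/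
theorem HsPer_apply_of_periodic (V : Site d → Fin d → (Matrix n n ℂ)ˣ) (W : Finset (T4AveragingDeficitWall.Plaq d))
    (P : ℕ) {Y Z : Site d → Fin d → Matrix n n ℂ} (hY : IsPeriodicDir Y (P : ℤ)) (hZ : IsPeriodicDir Z (P : ℤ)) :
    HsPer V W P Y Z = hessSym V W Y Z := by
  rw [HsPer_apply, perExt_eq_of_periodic P hY, perExt_eq_of_periodic P hZ]

/-- `HsPer V W P Y Y = hess V Y Y W` for `P`-periodic `Y` (what `coer` and `split` read). [folklore] -/
theorem HsPer_self_of_periodic (V : Site d → Fin d → (Matrix n n ℂ)ˣ) (W : Finset (T4AveragingDeficitWall.Plaq d))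
    (P : ℕ) {Y : Site d → Fin d → Matrix n n ℂ} (hY : IsPeriodicDir Y (P : ℤ)) : HsPer V W P Y Y = hess V Y Y W := by
  rw [HsPer_apply_of_periodic V W P hY hY, hessSym_self]

/-- **THE FIELD `cont` FOR ALL DIRECTIONS, `Λ = 48·d`**: for unitary `V`, any background `W`, `1 ≤ P` and ALL direction
fields `Y, Z`:  `|HsPer V (perWin d P) P Y Z| ≤ 48·d·energyNorm W Y (periodBox P)·energyNorm W Z (periodBox P)`
(k-uniform; in-box `dirSq` only). [folklore] -/
theorem abs_HsPer_le_energyNorm [Nonempty n] {V : Site d → Fin d → (Matrix n n ℂ)ˣ} (hV : IsUnitaryCfg V)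
    (W : Site d → Fin d → (Matrix n n ℂ)ˣ) {P : ℕ} (hP : 1 ≤ P) (Y Z : Site d → Fin d → Matrix n n ℂ) :
    |HsPer V (perWin d P) P Y Z| ≤ 48 * d * energyNorm W Y (periodBox P) * energyNorm W Z (periodBox P) := by
  rw [HsPer_apply]
  have h := abs_hessSym_perWin_le_dirSq hV hP (isPeriodicDir_perExt P Y) (isPeriodicDir_perExt P Z)
  rw [dirSq_perExt, dirSq_perExt] at h
  have hY' := sqrt_dirSq_le_energyNorm W Y (periodBox P)
  have hZ' := sqrt_dirSq_le_energyNorm W Z (periodBox P)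
  have hz0 : 0 ≤ Real.sqrt (dirSq Z (periodBox P)) := Real.sqrt_nonneg _
  have hprod : Real.sqrt (dirSq Y (periodBox P)) * Real.sqrt (dirSq Z (periodBox P))
      ≤ energyNorm W Y (periodBox P) * energyNorm W Z (periodBox P) :=
    mul_le_mul hY' hZ' hz0 (energyNorm_nonneg _ _ _)
  have hd : (0 : ℝ) ≤ 48 * (d : ℝ) := by positivity
  calc |hessSym V (perWin d P) (perExt P Y) (perExt P Z)|
      ≤ 48 * d * (Real.sqrt (dirSq Y (periodBox P)) * Real.sqrt (dirSq Z (periodBox P))) := h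
    _ ≤ 48 * d * (energyNorm W Y (periodBox P) * energyNorm W Z (periodBox P)) := mul_le_mul_of_nonneg_left hprod hd
    _ = 48 * d * energyNorm W Y (periodBox P) * energyNorm W Z (periodBox P) := by ring

/-- **`cont` ALONG A PATH OF UNITARY CONFIGURATIONS, ALL DIRECTIONS**: for a unitary background `W`, skew path fields
`Γ t`, `W_t := vary W (Γ t) 1`, `1 ≤ P`: for every `t` and ALL `Y, Z`,
`|HsPer W_t (perWin d P) P Y Z| ≤ 48·d·energyNorm W Y (periodBox P)·energyNorm W Z (periodBox P)` — the field `cont` of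
`NE3EnergyAssembly.RouteLeaves` verbatim for `Hs t := HsPer W_t (perWin d (N·L^k)) (N·L^k)`, `Λ := 48·d`. [folklore] -/
theorem cont_field [Nonempty n] {W : Site d → Fin d → (Matrix n n ℂ)ˣ} (hW : IsUnitaryCfg W)
    {Γ : ℝ → Site d → Fin d → Matrix n n ℂ} (hΓ : ∀ t, IsSkewDir (Γ t)) {P : ℕ} (hP : 1 ≤ P) :
    ∀ t ∈ Set.Icc (0 : ℝ) 1, ∀ Y Z : Site d → Fin d → Matrix n n ℂ,
      |(fun s : ℝ => HsPer (vary W (Γ s) 1) (perWin d P) P) t Y Z|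
        ≤ (48 * d) * energyNorm W Y (periodBox P) * energyNorm W Z (periodBox P) :=
  fun t _ Y Z => abs_HsPer_le_energyNorm (AveragingDeficitPlaqDeriv.vary_isUnitaryCfg hW (hΓ t) 1) W hP Y Z

/-- THE RIGHT-LOGARITHMIC VELOCITY OF A PERIODIC PATH IS PERIODIC: if every `Γ t` is `P`-periodic and `Ψ t` is a
bondwise right-logarithmic velocity (`hE` of leaf L3), then every `Ψ t` is `P`-periodic (uniqueness of the velocity,
`NE3EnergyPathC2Velocity.rvel_unique`) — the hypothesis of `symm_split_fields_HsPer` below. [folklore] -/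
theorem isPeriodicDir_rvel {Γ Ψ : ℝ → Site d → Fin d → Matrix n n ℂ} {P : ℤ} (hΓ : ∀ t, IsPeriodicDir (Γ t) P)
    (hE : ∀ t y κ, HasDerivAt (fun s => exp (Γ s y κ)) (exp (Γ t y κ) * Ψ t y κ) t) (t : ℝ) :
    IsPeriodicDir (Ψ t) P := by
  intro x i κ
  have h1 := hE t (x + P • e i) κ
  have hfun : (fun s => exp (Γ s (x + P • e i) κ)) = fun s => exp (Γ s x κ) :=
    funext fun s => by rw [hΓ s x i κ]
  rw [hfun, hΓ t x i κ] at h1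
  exact NE3EnergyPathC2Velocity.rvel_unique h1 (hE t x κ)

/-- **`symm` and `split` for `Hs t := HsPer W_t Wn P`** along a general path with PERIODIC velocities `Ψ t` (as for
B11's chart path on the torus): with leaf L3's `φ″ t = hess W_t (Ψ t) (Ψ t) Wn + dAction W_t (Ψ′ t) Wn`,
`uu t := Ψ t − X`, `e t := dAction W_t (Ψ′ t) Wn`, the clauses `symm`∕`split` of `RouteLeaves` hold verbatim for any
tangent datum `X`. [folklore] -/
theorem symm_split_fields_HsPer (W : Site d → Fin d → (Matrix n n ℂ)ˣ) {Γ Ψ Ψ' : ℝ → Site d → Fin d → Matrix n n ℂ}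
    (Wn : Finset (T4AveragingDeficitWall.Plaq d)) (P : ℕ) (hΨ : ∀ t, IsPeriodicDir (Ψ t) (P : ℤ))
    (X : Site d → Fin d → Matrix n n ℂ) :
    (∀ t ∈ Set.Icc (0 : ℝ) 1, ∀ x y : Site d → Fin d → Matrix n n ℂ,
        (fun s : ℝ => HsPer (vary W (Γ s) 1) Wn P) t x y = (fun s : ℝ => HsPer (vary W (Γ s) 1) Wn P) t y x) ∧
    (∀ t ∈ Set.Icc (0 : ℝ) 1,
        (fun s : ℝ => hess (vary W (Γ s) 1) (Ψ s) (Ψ s) Wn + dAction (vary W (Γ s) 1) (Ψ' s) Wn) t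
          = (fun s : ℝ => HsPer (vary W (Γ s) 1) Wn P) t (X + (fun s => Ψ s - X) t) (X + (fun s => Ψ s - X) t)
            + (fun s : ℝ => dAction (vary W (Γ s) 1) (Ψ' s) Wn) t) := by
  refine ⟨fun t _ x y => HsPer_symm _ _ _ x y, fun t _ => ?_⟩
  simp only [add_sub_cancel, HsPer_self_of_periodic _ _ _ (hΨ t)]

/-! ## §5 The curvature term `e t = dAction W_t (Ψ′ t) Wn` against the first-variation smallness (L7) -/

/-- **THE CURVATURE TERM OF THE DICTIONARY IS A FIRST VARIATION**: for unitary `V`, a skew ACCELERATION field `Z`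
(`= Ψ′ t`) and a plaquette radius `a` of `V` on the window, `|dAction V Z Wn| ≤ a·Σ_{p∈Wn} ‖(d_V Z)(p)‖`
(`NE3EnergySource.abs_firstVariation_le` BY NAME, applied to the derivative `dAction V Z Wn` of `s ↦ A_{Wn}(V e^{sZ})` at
`0`).  So the field `curv : |e t| ≤ κ·energyNorm X²` of `RouteLeaves` is REDUCED to the chart's acceleration bound
`a·Σ‖d_{W_t} Ψ′_t‖ ≤ κ·energyNorm X²` (path-specific, L2(b)). [folklore] -/
theorem abs_e_le {V : Site d → Fin d → (Matrix n n ℂ)ˣ} (hV : IsUnitaryCfg V) {Z : Site d → Fin d → Matrix n n ℂ}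
    (hZ : IsSkewDir Z) (Wn : Finset (T4AveragingDeficitWall.Plaq d)) {a : ℝ}
    (ha : ∀ p ∈ Wn, ‖((fhol V p : (Matrix n n ℂ)ˣ) : Matrix n n ℂ) - 1‖ ≤ a) :
    |dAction V Z Wn| ≤ a * ∑ p ∈ Wn, ‖curl V Z p‖ := by
  have hD := NE3HessForm.hasDerivAt_fineAction_vary_at V Z Wn 0
  rw [vary_zero] at hD
  exact abs_firstVariation_le hV hZ Wn ha hD

/-- `curv` from an acceleration bound: if `a·Σ_{p∈Wn}‖(d_{W_t} Ψ′_t)(p)‖ ≤ κ·E²` on `[0,1]` (the chart's input), then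
`|e t| ≤ κ·E²` for `e t := dAction W_t (Ψ′ t) Wn` — the field `curv` of `RouteLeaves` verbatim (with `E := energyNorm
(cavg L U_B) X (periodBox (N·L^k))`). [folklore] -/
theorem curv_field_of_accel {W : Site d → Fin d → (Matrix n n ℂ)ˣ} (hW : IsUnitaryCfg W)
    {Γ Ψ' : ℝ → Site d → Fin d → Matrix n n ℂ} (hΓ : ∀ t, IsSkewDir (Γ t)) (hΨ' : ∀ t, IsSkewDir (Ψ' t))
    (Wn : Finset (T4AveragingDeficitWall.Plaq d)) {a κ E : ℝ}
    (ha : ∀ t ∈ Set.Icc (0 : ℝ) 1, ∀ p ∈ Wn, ‖((fhol (vary W (Γ t) 1) p : (Matrix n n ℂ)ˣ) : Matrix n n ℂ) - 1‖ ≤ a)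
    (hacc : ∀ t ∈ Set.Icc (0 : ℝ) 1, a * ∑ p ∈ Wn, ‖curl (vary W (Γ t) 1) (Ψ' t) p‖ ≤ κ * E ^ 2) :
    ∀ t ∈ Set.Icc (0 : ℝ) 1, |(fun s : ℝ => dAction (vary W (Γ s) 1) (Ψ' s) Wn) t| ≤ κ * E ^ 2 :=
  fun t ht => (abs_e_le (AveragingDeficitPlaqDeriv.vary_isUnitaryCfg hW (hΓ t) 1) (hΨ' t) Wn (ha t ht)).trans (hacc t ht)

end

end Summit.QuantumFields.BalabanUV.T4Continuum.NE3EnergyHessCont
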